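import Mathlib.RingTheory.RootsOfUnity.Complex
import Mathlib.Analysis.Complex.Basic
import HarnessLib

/-!
# Schur–Fejér splitting window — the scalar algebraic core (PROVED, 0 sorry)

Ideator `ym-ir-idea-22` g4 · crux `IRcof` (stmt-QuantumFields-26930) · line `Cruxes/IRcof/Lines/equipartition_seam.lean` rev 4,
§7 (A) and crux idea `Ideas/schur-fejer-split.md`: the splitting weight for a cyclic kernel `Γ = ⟨k₀⟩ ≅ ℤ_N` acting through `ρH` by
`ω • 1` is `w = E_β · W_F`, `W_F(h) = G_N(u(h))/N²`, `u = tr ρH / dim ρH`, `G_N(u) = Σ_{j,l<N} u^{(j−l)}` (`u^{(n)} = u^n`, `ū^{|n|}`).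
This file proves the four scalar facts the window needs, for every `N : ℕ` and `u : ℂ`:

* `fejerSum_eq_sosForm` — the SUM-OF-SQUARES identity `G_N(u) = |Σ_{l<N} u^l|² + (1 − |u|²) Σ_{n<N} |Σ_{l<n} u^l|²`
  (Cholesky factor of the AR(1) Toeplitz matrix), whence `fejerSum_re_nonneg` (`G_N(u) ≥ 0` for `|u| ≤ 1`: the window is
  MANIFESTLY non-negative on the whole group, since `|tr ρH| ≤ dim ρH`) and `fejerSum_im` (`G_N(u)` is real);
* `fejerSum_one` — `G_N(1) = N²` (`W_F(1) = 1`);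
* `fejerSum_rootOfUnity` — `G_N(ζ) = 0` for `ζ^N = 1`, `ζ ≠ 1` (`W_F = 0` on `Γ ∖ {1}`: Fejér zeros);
* `fejerSum_exact` — `Σ_{m<N} G_N(ω^m u) = N²` for a primitive `N`-th root `ω` (EXACTNESS `Σ_{k∈Γ} W_F(k h) = 1`, i.e. clause 6 of
  `TwistSplitWeight` for `w = E_β W_F` with `Γ`-blind `E_β`).

What is NOT here (prover work, crux idea `schur-fejer-split`): positive type of `h ↦ W_F(u(h))` on the group (Schur products of the
positive-type `u`, `ū`), continuity ∕ centrality ∕ symmetry (those of `u`), and the Laplace step of clause 7 (noise `≍ 1/β`).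
HONEST: YM mass gap (Clay) NOT proved; `IRcof` 0∕1; this is scalar algebra for one stub (S2ᵛ) of one registered line.

LANDING NOTE (custody LEAD ym-ir-line-ab-p1 g7, LEAD LANE PROTOCOL (b); source `Cruxes/IRcof/Lines/equipartition_seam_SchurFejerCore.lean`
fdb49a6d782d by ym-ir-idea-22 g4): mathematics verbatim; gate-forced only — one-line docstrings added where the lint requires them; namespace kept
(`…EquipartitionSeam.SchurFejer`, critic's K3: short names `gs`∕`spow` stay namespaced — never `open` it wholesale downstream).  Helper `--supports stmt-QuantumFields-26930`; width 0.
-/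

set_option autoImplicit false

noncomputable section

open Finset Complex

namespace Summit.QuantumFields.YangMills.Cruxes.IRcof.EquipartitionSeam.SchurFejer

/-- Partial geometric sum `gs u n = Σ_{l<n} u^l`. -/
def gs (u : ℂ) (n : ℕ) : ℂ := ∑ l ∈ range n, u ^ l

/-- Signed power `u^{(j−l)}`: `u^{j−l}` if `l ≤ j`, `conj u^{l−j}` otherwise. -/
def spow (u : ℂ) (j l : ℕ) : ℂ := if l ≤ j then u ^ (j - l) else (starRingEnd ℂ u) ^ (l - j)

/-- The Fejér double sum `G_N(u) = Σ_{j,l<N} u^{(j−l)}` (the window is `G_N(u)/N²`). -/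
def fejerSum (u : ℂ) (N : ℕ) : ℂ := ∑ j ∈ range N, ∑ l ∈ range N, spow u j l

/-- The sum-of-squares form `|gs u N|² + (1 − |u|²) Σ_{n<N} |gs u n|²`. -/
def sosForm (u : ℂ) (N : ℕ) : ℝ := ‖gs u N‖ ^ 2 + (1 - ‖u‖ ^ 2) * ∑ n ∈ range N, ‖gs u n‖ ^ 2

/-- `gs u 0 = 0`. -/
lemma gs_zero (u : ℂ) : gs u 0 = 0 := by simp [gs]

/-- `gs u (n+1) = 1 + u · gs u n`. -/
lemma gs_succ (u : ℂ) (n : ℕ) : gs u (n + 1) = 1 + u * gs u n := by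
  unfold gs
  rw [Finset.sum_range_succ', Finset.mul_sum]
  simp [pow_succ, mul_comm, add_comm]

/-- `u^{(0)} = 1`. -/
lemma spow_self (u : ℂ) (j : ℕ) : spow u j j = 1 := by simp [spow]

/-- New column: `Σ_{l<N} u^{(N−l)} = u · gs u N`. -/
lemma sum_spow_left (u : ℂ) (N : ℕ) : ∑ l ∈ range N, spow u N l = u * gs u N := by
  have h1 : ∑ l ∈ range N, spow u N l = ∑ l ∈ range N, u ^ (N - l) := by
    refine Finset.sum_congr rfl fun l hl => ?_
    have hl' : l ≤ N := (Finset.mem_range.mp hl).le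
    simp [spow, hl']
  have h2 : ∑ l ∈ range N, u ^ (N - l) = ∑ l ∈ range N, u ^ (l + 1) := by
    rw [← Finset.sum_range_reflect (fun l => u ^ (l + 1)) N]
    refine Finset.sum_congr rfl fun l hl => ?_
    have hl' : l < N := Finset.mem_range.mp hl
    congr 1
    omega
  rw [h1, h2, gs, Finset.mul_sum]
  refine Finset.sum_congr rfl fun l _ => ?_
  ring

/-- New row: `Σ_{j<N} u^{(j−N)} = conj (u · gs u N)`. -/
lemma sum_spow_right (u : ℂ) (N : ℕ) :
    ∑ j ∈ range N, spow u j N = starRingEnd ℂ (u * gs u N) := by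
  have h1 : ∑ j ∈ range N, spow u j N = ∑ j ∈ range N, (starRingEnd ℂ u) ^ (N - j) := by
    refine Finset.sum_congr rfl fun j hj => ?_
    have hj' : ¬ (N ≤ j) := not_le.mpr (Finset.mem_range.mp hj)
    simp [spow, hj']
  have h2 : ∑ j ∈ range N, (starRingEnd ℂ u) ^ (N - j) = starRingEnd ℂ u * gs (starRingEnd ℂ u) N := by
    have := sum_spow_left (starRingEnd ℂ u) N
    rw [← this]
    refine Finset.sum_congr rfl fun j hj => ?_
    have hj' : j ≤ N := (Finset.mem_range.mp hj).le
    simp [spow, hj']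
  rw [h1, h2, map_mul]
  congr 1
  simp [gs, map_sum, map_pow]

/-- Recursion of the Fejér sum. -/
lemma fejerSum_succ (u : ℂ) (N : ℕ) :
    fejerSum u (N + 1) = fejerSum u N + (u * gs u N + starRingEnd ℂ (u * gs u N) + 1) := by
  unfold fejerSum
  rw [Finset.sum_range_succ]
  have hrow : ∀ j, ∑ l ∈ range (N + 1), spow u j l = (∑ l ∈ range N, spow u j l) + spow u j N :=
    fun j => Finset.sum_range_succ _ _
  simp only [hrow, Finset.sum_add_distrib, sum_spow_left, sum_spow_right, spow_self]
  ring

/-- Recursion of the SOS form. -/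
lemma sosForm_succ (u : ℂ) (N : ℕ) :
    sosForm u (N + 1) = sosForm u N + (2 * (u * gs u N).re + 1) := by
  unfold sosForm
  rw [Finset.sum_range_succ, gs_succ]
  have key : ‖(1 : ℂ) + u * gs u N‖ ^ 2 = 1 + 2 * (u * gs u N).re + ‖u‖ ^ 2 * ‖gs u N‖ ^ 2 := by
    rw [Complex.sq_norm, Complex.sq_norm, Complex.sq_norm, Complex.normSq_add]
    simp [Complex.normSq_mul]
    ring
  rw [key]
  ring

/-- **The SOS identity** `G_N(u) = |gs u N|² + (1 − |u|²) Σ_{n<N} |gs u n|²` (as complex numbers). -/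
theorem fejerSum_eq_sosForm (u : ℂ) (N : ℕ) : fejerSum u N = (sosForm u N : ℂ) := by
  induction N with
  | zero => simp [fejerSum, sosForm, gs]
  | succ N ih =>
    rw [fejerSum_succ, sosForm_succ, ih]
    have hre : u * gs u N + starRingEnd ℂ (u * gs u N) = (2 * (u * gs u N).re : ℝ) := by
      rw [Complex.add_conj]
    rw [hre]; push_cast; ring

/-- **Manifest non-negativity** of the Fejér window on the closed unit disc. -/
theorem sosForm_nonneg (u : ℂ) (hu : ‖u‖ ≤ 1) (N : ℕ) : 0 ≤ sosForm u N := by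
  unfold sosForm
  have h1 : 0 ≤ 1 - ‖u‖ ^ 2 := by nlinarith [norm_nonneg u]
  have h2 : 0 ≤ ∑ n ∈ range N, ‖gs u n‖ ^ 2 := Finset.sum_nonneg fun n _ => sq_nonneg _
  exact add_nonneg (sq_nonneg _) (mul_nonneg h1 h2)

/-- `Re G_N(u) ≥ 0` for `|u| ≤ 1` (manifest non-negativity of the window). -/
theorem fejerSum_re_nonneg (u : ℂ) (hu : ‖u‖ ≤ 1) (N : ℕ) : 0 ≤ (fejerSum u N).re := by
  rw [fejerSum_eq_sosForm, Complex.ofReal_re]; exact sosForm_nonneg u hu N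

/-- `G_N(u)` is real. -/
theorem fejerSum_im (u : ℂ) (N : ℕ) : (fejerSum u N).im = 0 := by
  rw [fejerSum_eq_sosForm, Complex.ofReal_im]

/-- `G_N(1) = N²` (the window equals `1` at the identity). -/
theorem fejerSum_one (N : ℕ) : fejerSum 1 N = (N : ℂ) ^ 2 := by
  simp [fejerSum, spow, sq]

/-- Geometric sum over a full period of a non-trivial root of unity vanishes. -/
lemma gs_eq_zero_of_pow_eq_one (ζ : ℂ) (N : ℕ) (hζN : ζ ^ N = 1) (hζ1 : ζ ≠ 1) : gs ζ N = 0 := by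
  unfold gs
  have h := geom_sum_mul ζ N   -- (Σ ζ^i) * (ζ - 1) = ζ^N - 1
  have hne : ζ - 1 ≠ 0 := sub_ne_zero.mpr hζ1
  have h0 : (∑ i ∈ range N, ζ ^ i) * (ζ - 1) = 0 := by rw [h, hζN, sub_self]
  exact (mul_eq_zero.mp h0).resolve_right hne

/-- `G_N(ζ) = 0` at every non-trivial `N`-th root of unity (the window vanishes on `Γ ∖ {1}`). -/
theorem fejerSum_rootOfUnity (ζ : ℂ) (N : ℕ) (hζN : ζ ^ N = 1) (hζ1 : ζ ≠ 1) : fejerSum ζ N = 0 := by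
  rcases Nat.eq_zero_or_pos N with rfl | hN
  · simp [fejerSum]
  have hnorm : ‖ζ‖ = 1 := Complex.norm_eq_one_of_pow_eq_one hζN hN.ne'
  have hgs : gs ζ N = 0 := gs_eq_zero_of_pow_eq_one ζ N hζN hζ1
  rw [fejerSum_eq_sosForm]
  simp [sosForm, hgs, hnorm]

/-- Rotation average of one signed monomial: only the diagonal survives. -/
lemma sum_spow_rotate (ω u : ℂ) (N : ℕ) (hω : IsPrimitiveRoot ω N) (j l : ℕ) (hj : j < N) (hl : l < N) :
    ∑ m ∈ range N, spow (ω ^ m * u) j l = if j = l then (N : ℂ) else 0 := by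
  rcases lt_trichotomy l j with hlt | heq | hgt
  · -- l < j : charged monomial u^(j-l), rotation phase ω^(j-l) ≠ 1
    have hne : j ≠ l := by omega
    rw [if_neg hne]
    have hd0 : 0 < j - l := by omega
    have hdN : j - l < N := by omega
    have hζ1 : ω ^ (j - l) ≠ 1 := hω.pow_ne_one_of_pos_of_lt hd0.ne' hdN
    have hζN : (ω ^ (j - l)) ^ N = 1 := by rw [← pow_mul, mul_comm, pow_mul, hω.pow_eq_one, one_pow]
    have hterm : ∀ m, spow (ω ^ m * u) j l = (ω ^ (j - l)) ^ m * u ^ (j - l) := by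
      intro m
      have h0 : spow (ω ^ m * u) j l = (ω ^ m * u) ^ (j - l) := by simp [spow, hlt.le]
      rw [h0, mul_pow, pow_right_comm]
    simp only [hterm, ← Finset.sum_mul]
    have := gs_eq_zero_of_pow_eq_one (ω ^ (j - l)) N hζN hζ1
    unfold gs at this
    rw [this, zero_mul]
  · subst heq; simp [spow_self]
  · -- j < l : conjugate monomial, rotation phase conj(ω)^(l-j) ≠ 1
    have hne : j ≠ l := by omega
    rw [if_neg hne]
    have hd0 : 0 < l - j := by omega
    have hdN : l - j < N := by omega
    have hω1 : ω ^ (l - j) ≠ 1 := hω.pow_ne_one_of_pos_of_lt hd0.ne' hdN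
    have hζ1 : (starRingEnd ℂ ω) ^ (l - j) ≠ 1 := by
      intro h
      apply hω1
      have h' : starRingEnd ℂ (ω ^ (l - j)) = starRingEnd ℂ 1 := by rw [map_pow, map_one, h]
      exact (RingHom.injective _ h')
    have hζN : ((starRingEnd ℂ ω) ^ (l - j)) ^ N = 1 := by
      rw [← pow_mul, mul_comm, pow_mul, ← map_pow, hω.pow_eq_one, map_one, one_pow]
    have hterm : ∀ m, spow (ω ^ m * u) j l =
        ((starRingEnd ℂ ω) ^ (l - j)) ^ m * (starRingEnd ℂ u) ^ (l - j) := by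
      intro m
      have h0 : spow (ω ^ m * u) j l = (starRingEnd ℂ (ω ^ m * u)) ^ (l - j) := by
        simp [spow, not_le.mpr hgt]
      rw [h0, map_mul, map_pow, mul_pow, pow_right_comm]
    simp only [hterm, ← Finset.sum_mul]
    have := gs_eq_zero_of_pow_eq_one ((starRingEnd ℂ ω) ^ (l - j)) N hζN hζ1
    unfold gs at this
    rw [this, zero_mul]

/-- **EXACTNESS**: averaging the Fejér sum over the `N` rotations `u ↦ ω^m u` gives the constant `N²`
(on the group: `Σ_{k∈Γ} W_F(k h) = 1`). -/
theorem fejerSum_exact (ω u : ℂ) (N : ℕ) (hω : IsPrimitiveRoot ω N) :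
    ∑ m ∈ range N, fejerSum (ω ^ m * u) N = (N : ℂ) ^ 2 := by
  unfold fejerSum
  rw [Finset.sum_comm]
  have h1 : ∀ j ∈ range N, ∑ m ∈ range N, ∑ l ∈ range N, spow (ω ^ m * u) j l = (N : ℂ) := by
    intro j hj
    rw [Finset.sum_comm]
    have h2 : ∀ l ∈ range N, ∑ m ∈ range N, spow (ω ^ m * u) j l = if j = l then (N : ℂ) else 0 :=
      fun l hl => sum_spow_rotate ω u N hω j l (Finset.mem_range.mp hj) (Finset.mem_range.mp hl)
    rw [Finset.sum_congr rfl h2, Finset.sum_ite_eq]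
    simp [hj]
  rw [Finset.sum_congr rfl h1]
  simp [sq]

end Summit.QuantumFields.YangMills.Cruxes.IRcof.EquipartitionSeam.SchurFejer
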